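import Summits.FinalStateConjecture.FinalStateConjecture.Theses.StarvedNecks
import Summits.FinalStateConjecture.FinalStateConjecture.Theorems.StarvedNecksHonestFixedRadiusSettlingOfT
import Summits.FinalStateConjecture.FinalStateConjecture.Theorems.HonestFixedRadiusSettling.Negative.KillShape
import Summits.FinalStateConjecture.FinalStateConjecture.Theorems.WeakCosmicCensorshipTame.Negative.LoadBearing
import Literature.Geometry.Lorentzian.TrivialDataAdmissible

/-!
# `HonestFixedRadiusSettlingT` (crux `stmt-FinalStateConjecture-17575`, route `StarvedNecks`, rank 3):
# read-back, kill shape, codimension scale and load-bearing hypotheses of the TAME generic import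

Negative-side support file of the crux disprover (cdisprove seat, cycle 1, 2026-08-17), `sorry`-free,
no named facts. `T` is TAME Christodoulou-genericity (`IsTameChristodoulouGeneric … 1`) inside
`admissibleVacuumData Σ`, for every `Σ`, of `P_T D`: an MGHD exists, and every MGHD has complete
`𝓘⁺` and a `C⁴` `FinalStateDecomposition` of its self-determined exterior `O` with
`RaysStayInClosure 𝒟 O`, `HonestCore ∧ HonestFar` and pairwise distinct hole four-velocities. It is
the rev-1 import `HonestFixedRadiusSettling` (13550; `Theorems/HonestFixedRadiusSettling/Negative/*`)
with three edits (tame genericity; rays clause; velocity clause); `T → rev-1` is the landed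
`Theorems.StarvedNecks.Retype.honestFixedRadiusSettling_of_T`. Recorded here:

* §0 READ-BACK: `velocitySet`, `honestDevelopmentsT`, `settlingSetT` and `T_iff` (`Iff.rfl`; no junk
  operator between text and sets); the two new conjuncts only shrink the property
  (`settlingSetT_subset_settlingSet`, `…_censoredSet`); the velocity clause is vacuous for `N ≤ 1`;
  the rays clause is monotone in `O` and empty for `O = univ` (its content is `O = exteriorOf …`).
* §1 KILL SHAPE: `not_T_iff_exists_trapped` — ONE `Σ` with an admissible `P_T`-exceptional datum
  through which every tame, immersed, injective admissible curve meets the exceptional set again;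
  `not_T_of_forall_not(_slice)`.
* §2 SCALE: `tameCodim_zero` (parameter `0` is free), `isTameChristodoulouGeneric_mono`,
  `hasTameCodimAtLeastIn_one_of_succ` / `not_tameCodim_succ_of_not_T` (restriction of a tame
  immersed family to an axis stays tame and immersed): `T` is the weakest positive-codimension
  version and all its content sits at `m = 1`.
* §3 TRANSFERS: `not_T_of_not_old` (¬ rev-1 ⇒ ¬ T); `wccTame_of_T` / `T_false_of_not_wccTame` (`T`
  contains the sibling crux `PhaseMixingCapture.WeakCosmicCensorshipTame`, 17269, verbatim);
  `exists_isMaximal_of_T` (a proof must produce an honest MAXIMAL development).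
* §4 LOAD-BEARING (transfers of the tame-WCC battery): `T_false_without_constraints` (FALSE without
  the vacuum constraints), `T_false_without_T2_of`, `trivialData_not_mem_settlingSetTWithoutIsMaximal`
  and `T_false_without_isMaximal_of` (the guard `𝒟.IsMaximal →`).

The consistency witness at the Minkowski development and the paper-level liabilities of the three
edits are in the crux workfile `Cruxes/HonestFixedRadiusSettlingT/Disproof.lean`.
References: Christodoulou, CQG 16 (1999) A23, p. A24; Dafermos–Rodnianski arXiv:0811.0354,
App. B.2.3, §2.6.2; Dafermos–Luk arXiv:1710.01722, p. 8 and Conjecture 1.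
-/

noncomputable section

open Literature.Geometry.Lorentzian
open scoped Manifold ContDiff ENNReal Topology
open Filter Set TopologicalSpace Function

namespace Summit.FinalStateConjecture.FinalStateConjecture.Theorems.HonestFixedRadiusSettlingT.Negative

open Summit.FinalStateConjecture.FinalStateConjecture.Theses.StarvedNecks
  (HonestFixedRadiusSettlingT HonestFixedRadiusSettling)
open Summit.FinalStateConjecture.FinalStateConjecture.Theorems.HonestFixedRadiusSettling.Negative
  (honestCoreSet honestFarSet honestDevelopments settlingSet censoredSet settlingSet_subset_censoredSet
    axisEmbed axisEmbed_eq_zero_iff axisEmbed_injective)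
open Summit.FinalStateConjecture.FinalStateConjecture.Theorems.WeakCosmicCensorshipTame.Negative
  (not_isTameGeneric_iff_exists_trapped not_isTameGeneric_of_forall_not
    wccTame_false_without_constraints wccTameWithoutT2_false_of isTameChristodoulouGeneric_admissible_zero)
open Summit.FinalStateConjecture.FinalStateConjecture.Theorems.WeakCosmicCensorshipMGHD.Negative
  (admissibleNoConstraint exists_vacuumCauchyDevelopment_trivialData_not_complete)
open Literature.Geometry.Lorentzian.InitialDataSet
  (IsTameDataFamily IsImmersedAtZero IsTameChristodoulouGeneric HasTameCodimAtLeastIn)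

/-! ### §0 Read-back of the crux -/

section Decompositions

variable {𝓢 : Spacetime.{0} 4} {O : Set 𝓢.carrier} {k : ℕ}

variable (𝓢 O k) in
/-- The decompositions with **pairwise distinct asymptotic four-velocities** `Λᵢ e₀ ≠ Λⱼ e₀`
(verbatim the conjunct appended after `Hf` in `T`; comoving and parabolic-threshold pairs are
declared exceptional). [cite: DafermosLuk2017, p. 8] -/
def velocitySet : Set (FinalStateDecomposition 𝓢 O k) :=
  {d | ∀ i j : Fin d.N, i ≠ j →
    ((d.motion i).1 : E4 ≃L[ℝ] E4) (E4.basisVector 0) ≠ ((d.motion j).1 : E4 ≃L[ℝ] E4) (E4.basisVector 0)}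

/-- The velocity clause is vacuous for `N ≤ 1` (dispersal, a single hole). [folklore] -/
theorem mem_velocitySet_of_N_le_one (d : FinalStateDecomposition 𝓢 O k) (hN : d.N ≤ 1) :
    d ∈ velocitySet 𝓢 O k := by
  intro i j hij
  have hi := i.isLt
  have hj := j.isLt
  exact absurd (Fin.ext (by omega)) hij

end Decompositions

section Pointwise

variable {X : Type} [TopologicalSpace X] [ChartedSpace E3 X] [IsManifold (𝓡 3) ∞ X]
  [ConnectedSpace X]

/-- The rays clause is monotone in the region. [folklore] -/
theorem raysStayInClosure_mono {D : InitialDataSet (𝓡 3) X} (𝒟 : CauchyDevelopment D)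
    {O O' : Set 𝒟.carrier} (hOO' : O ⊆ O') (h : RaysStayInClosure 𝒟 O) :
    RaysStayInClosure 𝒟 O' := by
  intro _ p γ dom hγ hdom t ht ht0
  exact closure_mono hOO' (h p γ dom hγ hdom t ht ht0)

/-- The rays clause is empty for `O = univ`: all its content lies in `O` being the self-determined
exterior `exteriorOf 𝒟 d.charted` of the witnessing charts. [folklore] -/
theorem raysStayInClosure_univ {D : InitialDataSet (𝓡 3) X} (𝒟 : CauchyDevelopment D) :
    RaysStayInClosure 𝒟 univ := by
  intro _ p γ dom _ _ t _ _
  simp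

/-- The vacuum Cauchy developments of `D` at which the universal conjunct of `P_T` holds: complete
`𝓘⁺`, and an honest `C⁴` decomposition `d` of the self-determined exterior `O` with the rays clause
and pairwise distinct hole velocities (verbatim; `HonestCore`/`HonestFar` are the rev-1 sets
`honestCoreSet`/`honestFarSet`). [cite: DafermosLuk2017, Conjecture 1] -/
def honestDevelopmentsT (D : InitialDataSet (𝓡 3) X) : Set (VacuumCauchyDevelopment D) :=
  {𝒟 | HasCompleteNullInfinity 𝒟.toCauchyDevelopment ∧
    ∃ (O : Set 𝒟.carrier) (d : FinalStateDecomposition 𝒟.toSpacetime O 4) (R₀ : ℝ),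
      O = exteriorOf 𝒟.toCauchyDevelopment d.charted ∧
        RaysStayInClosure 𝒟.toCauchyDevelopment O ∧
          d ∈ honestCoreSet 𝒟.toSpacetime O 4 R₀ ∧ d ∈ honestFarSet 𝒟.toSpacetime O 4 R₀ ∧
            d ∈ velocitySet 𝒟.toSpacetime O 4}

variable (X) in
/-- The property `P_T` of the crux, as a set of data: an MGHD exists and every MGHD lies in
`honestDevelopmentsT`. [cite: DafermosLuk2017, Conjecture 1] -/
def settlingSetT : Set (InitialDataSet (𝓡 3) X) :=
  {D | (∃ 𝒟 : VacuumCauchyDevelopment D, 𝒟.IsMaximal) ∧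
    ∀ 𝒟 : VacuumCauchyDevelopment D, 𝒟.IsMaximal → 𝒟 ∈ honestDevelopmentsT D}

/-- Forgetting the rays and velocity clauses: `T`-honest developments are rev-1-honest. [folklore] -/
theorem honestDevelopmentsT_subset (D : InitialDataSet (𝓡 3) X) :
    honestDevelopmentsT D ⊆ honestDevelopments D :=
  fun _ ⟨h₁, O, d, R₀, hO, _, hc, hf, _⟩ ↦ ⟨h₁, O, d, R₀, hO, hc, hf⟩

/-- `P_T ⇒ P` (the rev-1 property), pointwise. [folklore] -/
theorem settlingSetT_subset_settlingSet : settlingSetT X ⊆ settlingSet X :=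
  fun D ⟨h₁, h₂⟩ ↦ ⟨h₁, fun 𝒟 h𝒟 ↦ honestDevelopmentsT_subset D (h₂ 𝒟 h𝒟)⟩

/-- `P_T ⇒` censored (an MGHD exists and every MGHD has complete `𝓘⁺`), pointwise. [folklore] -/
theorem settlingSetT_subset_censoredSet : settlingSetT X ⊆ censoredSet X :=
  settlingSetT_subset_settlingSet.trans settlingSet_subset_censoredSet

end Pointwise

/-- **Read-back.** `T` is, for every `Σ`, TAME Christodoulou-genericity with codimension `1` of
membership in `settlingSetT Σ` — by `Iff.rfl` (the let-bound `Hc`, `Hf` zeta-reduce to membership in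
`honestCoreSet`, `honestFarSet`). [cite: Christodoulou1999, p. A24] -/
theorem T_iff :
    HonestFixedRadiusSettlingT ↔ ∀ (X : Type) [TopologicalSpace X] [ChartedSpace E3 X]
      [IsManifold (𝓡 3) ∞ X] [T2Space X] [SecondCountableTopology X] [ConnectedSpace X],
      IsTameChristodoulouGeneric (admissibleVacuumData X) (· ∈ settlingSetT X) 1 :=
  Iff.rfl

/-! ### §1 Shape of any kill -/

/-- **Exact shape of a refutation of `T`.** `T` fails iff SOME `Σ` carries an admissible
`P_T`-exceptional datum `d` which is TRAPPED: every curve of admissible data through `d`, tame on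
some end, immersed at `0` and injective, has a `P_T`-exceptional member at a nonzero parameter.
Tame curves being jointly smooth only on compacta and `wDist`-continuous only at `c = 0`, a trap
needs a failure of `P_T` robust under `C^∞_loc`-small, weighted-`C²`-small perturbations — an OPEN
set of counterexamples to weak cosmic censorship or to Kerr settling. [cite: Christodoulou1999, p. A24] -/
theorem not_T_iff_exists_trapped :
    ¬ HonestFixedRadiusSettlingT ↔
      ∃ (X : Type) (_ : TopologicalSpace X) (_ : ChartedSpace E3 X) (_ : IsManifold (𝓡 3) ∞ X)
        (_ : T2Space X) (_ : SecondCountableTopology X) (_ : ConnectedSpace X),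
        ∃ d ∈ admissibleVacuumData X, d ∉ settlingSetT X ∧
          ∀ (e : AFEnd X) (F : EuclideanSpace ℝ (Fin 1) → InitialDataSet (𝓡 3) X),
            IsTameDataFamily e 1 F → IsImmersedAtZero 1 F → F 0 = d → Injective F →
              (∀ c, F c ∈ admissibleVacuumData X) → ∃ c, c ≠ 0 ∧ F c ∉ settlingSetT X := by
  constructor
  · intro h
    by_contra hne
    refine h (T_iff.2 fun X _ _ _ _ _ _ ↦ ?_)
    by_contra hX
    exact hne ⟨X, ‹_›, ‹_›, ‹_›, ‹_›, ‹_›, ‹_›,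
      (not_isTameGeneric_iff_exists_trapped (· ∈ settlingSetT X)).1 hX⟩
  · rintro ⟨X, _, _, _, _, _, _, hX⟩ hT
    exact (not_isTameGeneric_iff_exists_trapped (· ∈ settlingSetT X)).2 hX (T_iff.1 hT X)

/-- **Sufficient kill shape.** One `Σ` with an admissible datum such that `P_T` fails for EVERY
admissible datum of `Σ` refutes `T` (the members of any would-be witness curve at `c ≠ 0` are
admissible, hence exceptional). [cite: Christodoulou1999, p. A24] -/
theorem not_T_of_forall_not (X : Type) [TopologicalSpace X] [ChartedSpace E3 X]
    [IsManifold (𝓡 3) ∞ X] [T2Space X] [SecondCountableTopology X] [ConnectedSpace X]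
    {d : InitialDataSet (𝓡 3) X} (hd : d ∈ admissibleVacuumData X)
    (hall : ∀ D ∈ admissibleVacuumData X, D ∉ settlingSetT X) : ¬ HonestFixedRadiusSettlingT :=
  fun hT ↦ not_isTameGeneric_of_forall_not (· ∈ settlingSetT X) hd hall (T_iff.1 hT X)

/-- **Kill shape on `ℝ³`**: the admissible class of the Minkowski slice is inhabited by the trivial
datum (`trivialData_mem_admissibleVacuumData`), so identical failure of `P_T` on it refutes `T`.
(The workfile's Minkowski witness shows such a failure would have to come through maximality alone
at the trivial datum.) [cite: Christodoulou1999, p. A24] -/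
theorem not_T_of_forall_not_slice
    (hall : ∀ D ∈ admissibleVacuumData Minkowski.slice, D ∉ settlingSetT Minkowski.slice) :
    ¬ HonestFixedRadiusSettlingT :=
  not_T_of_forall_not Minkowski.slice trivialData_mem_admissibleVacuumData hall

/-! ### §2 The codimension scale -/

section Scale

variable {X : Type} [TopologicalSpace X] [ChartedSpace E3 X] [IsManifold (𝓡 3) ∞ X]

/-- **Tame genericity is antitone in the exceptional set** (monotone in the property): the witness
curve through a `Q`-exceptional datum is the one through the same, `P`-exceptional, datum.
[cite: Christodoulou1999, p. A24] -/
theorem isTameChristodoulouGeneric_mono {𝓓 : Set (InitialDataSet (𝓡 3) X)}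
    {P Q : InitialDataSet (𝓡 3) X → Prop} (hPQ : ∀ d ∈ 𝓓, P d → Q d) {m : ℕ}
    (hP : IsTameChristodoulouGeneric 𝓓 P m) : IsTameChristodoulouGeneric 𝓓 Q m := by
  intro d hd
  obtain ⟨e, F, hF, himm, h0, hinj, hmem, hE⟩ := hP d ⟨hd.1, fun h ↦ hd.2 (hPQ d hd.1 h)⟩
  exact ⟨e, F, hF, himm, h0, hinj, hmem,
    fun c hc hc' ↦ hE c hc ⟨hc'.1, fun h ↦ hc'.2 (hPQ _ hc'.1 h)⟩⟩

/-- Chain rule on the axis: a non-vanishing directional derivative of `f` at `0` along the embedded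
axis is a non-vanishing derivative of `f ∘ axisEmbed m` at `0`. [folklore] -/
theorem fderiv_comp_axisEmbed_ne_zero {m : ℕ} {f : EuclideanSpace ℝ (Fin (m + 1)) → ℝ}
    {v : EuclideanSpace ℝ (Fin 1)} (h : fderiv ℝ f 0 (axisEmbed m v) ≠ 0) :
    fderiv ℝ (fun c ↦ f (axisEmbed m c)) 0 v ≠ 0 := by
  have hd : DifferentiableAt ℝ f (axisEmbed m 0) := by
    rw [map_zero]
    by_contra hnd
    rw [fderiv_zero_of_not_differentiableAt hnd] at h
    exact h rfl
  have hcomp : (fun c ↦ f (axisEmbed m c)) = f ∘ axisEmbed m := rfl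
  rw [hcomp, fderiv_comp (0 : EuclideanSpace ℝ (Fin 1)) hd (axisEmbed m).differentiableAt,
    ContinuousLinearMap.comp_apply, (axisEmbed m).fderiv, map_zero]
  exact h

/-- **Tame codimension is monotone**: tame codimension `≥ m + 1` inside `𝓓` gives `≥ 1` — the
restriction of the witness family to the first axis is tame on the same end (smoothness, mass and
`wDist`-continuity compose), immersed (chain rule), injective, and escapes. [cite: Christodoulou1999, p. A24] -/
theorem hasTameCodimAtLeastIn_one_of_succ {𝓓 𝓔 : Set (InitialDataSet (𝓡 3) X)} {m : ℕ}
    (h : HasTameCodimAtLeastIn 𝓓 𝓔 (m + 1)) : HasTameCodimAtLeastIn 𝓓 𝓔 1 := by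
  intro d hd
  obtain ⟨e, F, hF, himm, h0, hinj, hmem, hE⟩ := h d hd
  have hι : ContMDiff (𝓘(ℝ, EuclideanSpace ℝ (Fin 1)).prod (𝓡 3))
      (𝓘(ℝ, EuclideanSpace ℝ (Fin (m + 1))).prod (𝓡 3)) ∞
      (fun p : EuclideanSpace ℝ (Fin 1) × X ↦ (axisEmbed m p.1, p.2)) :=
    ((axisEmbed m).contMDiff.comp contMDiff_fst).prodMk contMDiff_snd
  have hax0 : axisEmbed m 0 = 0 := map_zero _
  refine ⟨e, fun c ↦ F (axisEmbed m c), ?_, ?_, ?_, hinj.comp (axisEmbed_injective m),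
    fun c ↦ hmem _, ?_⟩
  · obtain ⟨hsm, hsole, ⟨M, hMc, hM⟩, hw⟩ := hF
    refine ⟨⟨hsm.1.comp hι, hsm.2.comp hι⟩, hsole,
      ⟨fun c ↦ M (axisEmbed m c), hMc.comp (axisEmbed m).continuous, fun c ↦ hM _⟩, ?_⟩
    have hax : Tendsto (axisEmbed m) (𝓝 0) (𝓝 0) := by
      simpa only [hax0] using (axisEmbed m).continuous.tendsto 0
    simpa only [Function.comp_def, hax0] using hw.comp hax
  · intro v hv
    obtain ⟨x, u, w, huw⟩ := himm (axisEmbed m v) fun h' ↦ hv ((axisEmbed_eq_zero_iff m v).1 h')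
    refine ⟨x, u, w, huw.imp (fun h₁ ↦ ?_) (fun h₂ ↦ ?_)⟩
    · exact fderiv_comp_axisEmbed_ne_zero (f := fun c ↦ (F c).h.inner x u w) h₁
    · exact fderiv_comp_axisEmbed_ne_zero (f := fun c ↦ (F c).k x u w) h₂
  · show F (axisEmbed m 0) = d
    rw [hax0, h0]
  · intro c hc
    exact hE _ fun h' ↦ hc ((axisEmbed_eq_zero_iff m c).1 h')

/-- Tame Christodoulou genericity with codimension `m + 1` implies it with codimension `1`.
[cite: Christodoulou1999, p. A24] -/
theorem isTameChristodoulouGeneric_one_of_succ {𝓓 : Set (InitialDataSet (𝓡 3) X)}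
    {P : InitialDataSet (𝓡 3) X → Prop} {m : ℕ} (h : IsTameChristodoulouGeneric 𝓓 P (m + 1)) :
    IsTameChristodoulouGeneric 𝓓 P 1 :=
  hasTameCodimAtLeastIn_one_of_succ h

end Scale

/-- **The codimension `1` is the whole content of `T`**: with parameter `0` the statement holds
outright (constant families on the sole end granted by admissibility). [cite: Christodoulou1999, p. A24] -/
theorem tameCodim_zero (X : Type) [TopologicalSpace X] [ChartedSpace E3 X] [IsManifold (𝓡 3) ∞ X]
    [T2Space X] [SecondCountableTopology X] [ConnectedSpace X] :
    IsTameChristodoulouGeneric (admissibleVacuumData X) (· ∈ settlingSetT X) 0 :=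
  isTameChristodoulouGeneric_admissible_zero X _

/-- **`T` is the weakest positive-codimension version**: a refutation of `T` refutes every
higher-codimension strengthening (Christodoulou's scalar-field theorem is codimension `2`). [cite: Christodoulou1999, p. A24] -/
theorem not_tameCodim_succ_of_not_T (h : ¬ HonestFixedRadiusSettlingT) (m : ℕ) :
    ¬ ∀ (X : Type) [TopologicalSpace X] [ChartedSpace E3 X] [IsManifold (𝓡 3) ∞ X] [T2Space X]
      [SecondCountableTopology X] [ConnectedSpace X],
      IsTameChristodoulouGeneric (admissibleVacuumData X) (· ∈ settlingSetT X) (m + 1) :=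
  fun hm ↦ h (T_iff.2 fun X _ _ _ _ _ _ ↦ isTameChristodoulouGeneric_one_of_succ (hm X))

/-! ### §3 What a refutation elsewhere gives -/

/-- **¬ rev-1 ⇒ ¬ T** (by the landed `Retype.honestFixedRadiusSettling_of_T`): every refutation of
the rev-1 statement, and every `Negative/` lemma of `Theorems/HonestFixedRadiusSettling/` concluding
`¬ HonestFixedRadiusSettling` from a hypothesis, is one of `T`. [cite: Christodoulou1999, p. A24] -/
theorem not_T_of_not_old (h : ¬ HonestFixedRadiusSettling) : ¬ HonestFixedRadiusSettlingT :=
  fun hT ↦ h (Theorems.StarvedNecks.Retype.honestFixedRadiusSettling_of_T hT)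

/-- **`T` contains TAME weak cosmic censorship** (monotonicity): verbatim (definitionally) the
sibling crux `PhaseMixingCapture.WeakCosmicCensorshipTame` (item 17269), written out so that no
other route file is imported. [cite: arXiv08110354, §2.6.2] -/
theorem wccTame_of_T (hT : HonestFixedRadiusSettlingT) (X : Type) [TopologicalSpace X]
    [ChartedSpace E3 X] [IsManifold (𝓡 3) ∞ X] [T2Space X] [SecondCountableTopology X]
    [ConnectedSpace X] :
    IsTameChristodoulouGeneric (admissibleVacuumData X)
      (fun D ↦ (∃ 𝒟 : VacuumCauchyDevelopment D, 𝒟.IsMaximal) ∧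
        ∀ 𝒟 : VacuumCauchyDevelopment D, 𝒟.IsMaximal →
          HasCompleteNullInfinity 𝒟.toCauchyDevelopment) 1 :=
  isTameChristodoulouGeneric_mono (fun _ _ hD ↦ settlingSetT_subset_censoredSet hD) (T_iff.1 hT X)

/-- **Negative lemma modulo ¬(tame WCC).** Any disproof of tame weak cosmic censorship
(`PhaseMixingCapture.WeakCosmicCensorshipTame`, stated verbatim) kills `T`. [cite: arXiv08110354, §2.6.2] -/
theorem T_false_of_not_wccTame
    (h : ¬ ∀ (X : Type) [TopologicalSpace X] [ChartedSpace E3 X] [IsManifold (𝓡 3) ∞ X] [T2Space X]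
      [SecondCountableTopology X] [ConnectedSpace X],
      IsTameChristodoulouGeneric (admissibleVacuumData X)
        (fun D ↦ (∃ 𝒟 : VacuumCauchyDevelopment D, 𝒟.IsMaximal) ∧
          ∀ 𝒟 : VacuumCauchyDevelopment D, 𝒟.IsMaximal →
            HasCompleteNullInfinity 𝒟.toCauchyDevelopment) 1) :
    ¬ HonestFixedRadiusSettlingT :=
  fun hT ↦ h fun X _ _ _ _ _ _ ↦ wccTame_of_T hT X

/-- **Existential content of `T`.** `T` implies that SOME admissible datum on `ℝ³` has a MAXIMAL
vacuum Cauchy development in `honestDevelopmentsT`; the tree proves maximality of no development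
unconditionally (Minkowski space is the MGHD of the trivial data only modulo the
Choquet-Bruhat–Geroch fact, `CompleteDevelopmentMaximal.lean`). [cite: ChoquetBruhatGeroch1969CMP, Thm. 3] -/
theorem exists_isMaximal_of_T (h : HonestFixedRadiusSettlingT) :
    ∃ D ∈ admissibleVacuumData Minkowski.slice, ∃ 𝒟 : VacuumCauchyDevelopment D,
      𝒟.IsMaximal ∧ 𝒟 ∈ honestDevelopmentsT D := by
  by_contra hno
  refine not_T_of_forall_not_slice (fun D hD hDT ↦ ?_) h
  obtain ⟨⟨𝒟, hmax⟩, hall⟩ := hDT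
  exact hno ⟨D, hD, 𝒟, hmax, hall 𝒟 hmax⟩

/-! ### §4 Load-bearing hypotheses -/

/-- **Without the vacuum constraints `T` is FALSE**: `T` over `admissibleNoConstraint Σ`
(`D.IsVacuumConstraintSolution` deleted, everything else verbatim) implies constraint-free TAME weak
cosmic censorship, refuted in the sibling battery by the trapped bump datum `(ℝ³, δ, ψ(‖y‖²) δ)`
(Hamiltonian constraint `6` at the origin, continuously along any jointly smooth curve, so nearby
members have no vacuum Cauchy development; `wccTame_false_without_constraints`). [cite: Christodoulou1999, p. A24] -/
theorem T_false_without_constraints :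
    ¬ ∀ (X : Type) [TopologicalSpace X] [ChartedSpace E3 X] [IsManifold (𝓡 3) ∞ X] [T2Space X]
      [SecondCountableTopology X] [ConnectedSpace X],
      IsTameChristodoulouGeneric (admissibleNoConstraint X) (· ∈ settlingSetT X) 1 :=
  fun h ↦ wccTame_false_without_constraints fun X _ _ _ _ _ _ ↦
    isTameChristodoulouGeneric_mono (fun _ _ hD ↦ settlingSetT_subset_censoredSet hD) (h X)

/-- **`[T2Space Σ]` is load-bearing (degenerately)**: `T` with `[T2Space Σ]` deleted is false as
soon as one non-Hausdorff `Σ` carries an admissible datum (no datum on it has a vacuum Cauchy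
development; transfer of `wccTameWithoutT2_false_of`). [cite: ChoquetBruhatGeroch1969CMP, p. 330] -/
theorem T_false_without_T2_of
    (H : ∃ (Y : Type) (_ : TopologicalSpace Y) (_ : ChartedSpace E3 Y)
      (_ : IsManifold (𝓡 3) ∞ Y) (_ : SecondCountableTopology Y) (_ : ConnectedSpace Y),
      ¬ T2Space Y ∧ (admissibleVacuumData Y).Nonempty) :
    ¬ ∀ (X : Type) [TopologicalSpace X] [ChartedSpace E3 X] [IsManifold (𝓡 3) ∞ X]
      [SecondCountableTopology X] [ConnectedSpace X],
      IsTameChristodoulouGeneric (admissibleVacuumData X) (· ∈ settlingSetT X) 1 :=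
  fun h ↦ wccTameWithoutT2_false_of H fun X _ _ _ _ _ ↦
    isTameChristodoulouGeneric_mono (fun _ _ hD ↦ settlingSetT_subset_censoredSet hD) (h X)

section Maximality

variable {X : Type} [TopologicalSpace X] [ChartedSpace E3 X] [IsManifold (𝓡 3) ∞ X]
  [ConnectedSpace X]

variable (X) in
/-- `P_T` with the guard `𝒟.IsMaximal →` deleted from its universal conjunct (every vacuum Cauchy
development, maximal or not, must be `T`-honest). [cite: ChoquetBruhatGeroch1969CMP, Thm. 3] -/
def settlingSetTWithoutIsMaximal : Set (InitialDataSet (𝓡 3) X) :=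
  {D | (∃ 𝒟 : VacuumCauchyDevelopment D, 𝒟.IsMaximal) ∧
    ∀ 𝒟 : VacuumCauchyDevelopment D, 𝒟 ∈ honestDevelopmentsT D}

/-- The unguarded property implies `P_T`. [folklore] -/
theorem settlingSetTWithoutIsMaximal_subset : settlingSetTWithoutIsMaximal X ⊆ settlingSetT X :=
  fun _ ⟨h₁, h₂⟩ ↦ ⟨h₁, fun 𝒟 _ ↦ h₂ 𝒟⟩

end Maximality

/-- **The maximality guard is load-bearing, step 1: without it the trivial datum is exceptional.**
The time-truncated Minkowski space `{x⁰ < 1}` is a vacuum Cauchy development of `(ℝ³, δ, 0)` whose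
`𝓘⁺` is incomplete in the sojourn form (`exists_vacuumCauchyDevelopment_trivialData_not_complete`,
sibling battery `WeakCosmicCensorshipMGHD/Negative/TruncatedMinkowski.lean`), so it is not
`T`-honest. [cite: Christodoulou1999, p. A27] -/
theorem trivialData_not_mem_settlingSetTWithoutIsMaximal :
    trivialData ∉ settlingSetTWithoutIsMaximal Minkowski.slice := by
  rintro ⟨-, hall⟩
  obtain ⟨𝒟, h𝒟⟩ := exists_vacuumCauchyDevelopment_trivialData_not_complete
  exact h𝒟 (hall 𝒟).1

/-- **The maximality guard is load-bearing, step 2**: modulo the (true, unconstructed) fact that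
every admissible datum on `ℝ³` has SOME vacuum Cauchy development with incomplete `𝓘⁺` (local
existence, then time truncation), `T` with the guard deleted is FALSE: every admissible datum on
`ℝ³` is then exceptional and no curve escapes. [cite: ChoquetBruhatGeroch1969CMP, p. 330] -/
theorem T_false_without_isMaximal_of
    (H : ∀ D ∈ admissibleVacuumData Minkowski.slice, ∃ 𝒟 : VacuumCauchyDevelopment D,
      ¬ HasCompleteNullInfinity 𝒟.toCauchyDevelopment) :
    ¬ ∀ (X : Type) [TopologicalSpace X] [ChartedSpace E3 X] [IsManifold (𝓡 3) ∞ X] [T2Space X]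
      [SecondCountableTopology X] [ConnectedSpace X],
      IsTameChristodoulouGeneric (admissibleVacuumData X) (· ∈ settlingSetTWithoutIsMaximal X) 1 := by
  intro h
  refine not_isTameGeneric_of_forall_not _ trivialData_mem_admissibleVacuumData
    (fun D hD hDT ↦ ?_) (h Minkowski.slice)
  obtain ⟨𝒟, h𝒟⟩ := H D hD
  exact h𝒟 (hDT.2 𝒟).1

end Summit.FinalStateConjecture.FinalStateConjecture.Theorems.HonestFixedRadiusSettlingT.Negative

end
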